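import Summits.QuantumFields.YangMills.Theses.CertificationLength
import Summits.QuantumFields.YangMills.Theorems.ConvexGribovBodyNonSimplyConnectedLatticeGapAdmissibleInstance

/-!
# Crux-ideate sketch (ideator 2, round 1) for `CertifiedHypercubicLimit` (stmt-QuantumFields-16191)

First lemmas of the two idea cards, typed over existing declarations.

* §A  card `kill-the-antecedent` — the crux is an implication `(A) → X`; a kill of
  `CompleteAnalyticityAtLargeScales` (item 16178) at ONE admissible instance closes it ex falso.
  `certifiedHypercubicLimit_of_not_completeAnalyticity` (proved), the typed no-certificate statement
  for `SO(3)` `NoCertificateSO3`, and `not_completeAnalyticity_of_noCertificateSO3` (proved: pure logic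
  with the tree's admissible instance `isCompactSimpleLieGroup_SO3`).
* §B  card `centre-flip-thermal-floor` — the exact one-layer centre flip of the Wilson specification:
  `flipLayer`, `wilsonBoundaryAction_flipLayer`, `ymSpecification_map_flipLayer` (sorried: first stubs).
-/

set_option autoImplicit false

noncomputable section

open MeasureTheory
open Literature.MathematicalPhysics.QuantumFieldTheory Literature.MathematicalPhysics.QuantumLattice
open Literature.Probability.LatticeModels (Site)
open Literature.AlgebraicTopology.FundamentalGroup (SO3)
open Summit.QuantumFields.YangMills.Theses.CertificationLength
open Summit.QuantumFields.YangMills.Theorems.NonSimplyConnectedLatticeGap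
  (so3_isTopologicalGroup so3_compactSpace isCompactSimpleLieGroup_SO3)

namespace Summit.QuantumFields.YangMills.Cruxes.CertifiedHypercubicLimit.Ideator2

/-! ## §A  Kill the antecedent -/

/-- **Ex falso**: the crux (L) is `(A) → X`, so any refutation of (A) proves it. [folklore] -/
theorem certifiedHypercubicLimit_of_not_completeAnalyticity
    (h : ¬ CompleteAnalyticityAtLargeScales) : CertifiedHypercubicLimit := by
  unfold CertifiedHypercubicLimit
  intro E hA
  exact absurd hA h

section Vocabulary

variable {G : Type} [Group G] [TopologicalSpace G] [IsTopologicalGroup G] [CompactSpace G]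
  [MeasurableSpace G] [BorelSpace G]

/-- The Dobrushin–Shlosman total-variation finite-size condition of `FiniteSizeCriterion` at
coupling `β`, cell size `b`, window `n`, threshold `ε` — VERBATIM the certificate clause of (A) and (L)
(same text as `Certified` of `Lines/certified_telescoping.lean`). -/
def Certified {N : ℕ} (ρ : G →* Matrix (Fin N) (Fin N) ℂ) (β : ℝ) (b n : ℕ) (ε : ℝ) : Prop :=
  ∀ w : Fin 4 → ℤ → ℤ, (∀ i j, w i j + ((b : ℕ) : ℤ) ≤ w i (j + 1) ∧ w i (j + 1) ≤ w i j + 2 * ((b : ℕ) : ℤ)) →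
    ∀ Y : Finset (Fin 4 → ℤ), Y ⊆ (Fintype.piFinset fun _ : Fin 4 => Finset.Icc (-(2 * ((n : ℕ) : ℤ))) (2 * ((n : ℕ) : ℤ))) →
    (0 : Fin 4 → ℤ) ∈ Y → ∀ η η' : LGConfig 4 G,
    (∀ e ∈ (Fintype.piFinset fun _ : Fin 4 => Finset.Icc (-(2 * ((n : ℕ) : ℤ))) (2 * ((n : ℕ) : ℤ))).biUnion
      (fun y : Fin 4 → ℤ => (Fintype.piFinset fun i : Fin 4 => Finset.Ico (w i (y i)) (w i (y i + 1))) ×ˢ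
        (Finset.univ : Finset (Fin 4))), η e = η' e) →
    ∀ f : LGConfig 4 G → ℝ, IsCylinder f ((fun y : Fin 4 → ℤ => (Fintype.piFinset fun i : Fin 4 =>
      Finset.Ico (w i (y i)) (w i (y i + 1))) ×ˢ (Finset.univ : Finset (Fin 4))) 0) → Measurable f →
    (∀ U, 0 ≤ f U ∧ f U ≤ 1) →
    |(∫ U, f U ∂(ymSpecification ρ β (Y.biUnion (fun y : Fin 4 → ℤ => (Fintype.piFinset
        fun i : Fin 4 => Finset.Ico (w i (y i)) (w i (y i + 1))) ×ˢ (Finset.univ : Finset (Fin 4)))) η)) -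
      ∫ U, f U ∂(ymSpecification ρ β (Y.biUnion (fun y : Fin 4 → ℤ => (Fintype.piFinset
        fun i : Fin 4 => Finset.Ico (w i (y i)) (w i (y i + 1))) ×ˢ (Finset.univ : Finset (Fin 4)))) η')| ≤ ε

end Vocabulary

/-- **No DS certificate for `SO(3)` at large `β` (the typed kill target of (A); physics-grade by forced
`π₁`-monopole world-lines, `Cruxes/NonSimplyConnectedLatticeGap/ForcedMonopoleLines.md`)**: for SOME
lattice representation `r` of `SO(3)` and EVERY admissible window/threshold `(n, ε)` there is a frame bound
`B` such that at arbitrarily large `β` NO cell size `b ≥ B` is certified. -/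
def NoCertificateSO3 : Prop :=
  haveI : IsTopologicalGroup SO3 := so3_isTopologicalGroup
  haveI : CompactSpace SO3 := so3_compactSpace
  letI : MeasurableSpace SO3 := borel SO3
  haveI : BorelSpace SO3 := ⟨rfl⟩
  ∃ r : LatticeRep SO3, ∀ (n : ℕ) (ε : ℝ), 1 ≤ n → 0 ≤ ε →
    ε * ((((4 * n + 3) ^ 4 - (4 * n + 1) ^ 4 : ℕ)) : ℝ) < 1 →
    ∃ B : ℕ, ∀ β₂ : ℝ, ∃ β : ℝ, β₂ ≤ β ∧ ∀ b : ℕ, B ≤ b → 1 ≤ b → ¬ Certified r.ρ β b n ε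

/-- **`NoCertificateSO3` refutes (A)** — `SO(3)` is an admissible instance of
`CompleteAnalyticityAtLargeScales` (`isCompactSimpleLieGroup_SO3`, landed), and (A) at `(SO(3), r)` asserts
exactly what `NoCertificateSO3` denies. Pure logic. [folklore] -/
theorem not_completeAnalyticity_of_noCertificateSO3 (h : NoCertificateSO3) :
    ¬ CompleteAnalyticityAtLargeScales := by
  intro hA
  haveI : IsTopologicalGroup SO3 := so3_isTopologicalGroup
  haveI : CompactSpace SO3 := so3_compactSpace
  obtain ⟨r, hr⟩ := h
  obtain ⟨n, ε, hn, hε, hM, hB⟩ := hA SO3 isCompactSimpleLieGroup_SO3 r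
  obtain ⟨B, hBβ⟩ := hr n ε hn hε hM
  obtain ⟨β₂, hβ₂⟩ := hB B
  obtain ⟨β, hββ, hno⟩ := hBβ β₂
  obtain ⟨b, hBb, h1b, hcl⟩ := hβ₂ β hββ
  exact hno b hBb h1b hcl

/-- **The crux ex falso from the `SO(3)` kill.** [folklore] -/
theorem certifiedHypercubicLimit_of_noCertificateSO3 (h : NoCertificateSO3) : CertifiedHypercubicLimit :=
  certifiedHypercubicLimit_of_not_completeAnalyticity (not_completeAnalyticity_of_noCertificateSO3 h)

/-! ## §B  The one-layer centre flip of the Wilson specification -/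

section Flip

variable {G : Type} [Group G]

/-- **Layer flip**: multiply every TEMPORAL link based in the time layer `x₀ = t₀` by the central element
`z` (the centre transformation of finite-temperature gauge theory, acting on one layer of `ℤ⁴`). -/
def flipLayer (z : G) (t₀ : ℤ) (U : LGConfig 4 G) : LGConfig 4 G :=
  fun e => if e.2 = 0 ∧ e.1 0 = t₀ then z * U e else U e

/-- The layer flip is an involution up to `z ↦ z⁻¹`: flipping by `z⁻¹` undoes flipping by `z`. [folklore] -/
theorem flipLayer_inv_flipLayer (z : G) (t₀ : ℤ) (U : LGConfig 4 G) :
    flipLayer z⁻¹ t₀ (flipLayer z t₀ U) = U := by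
  funext e
  unfold flipLayer
  split_ifs with h
  · rw [← mul_assoc, inv_mul_cancel, one_mul]
  · rfl

/-- **Every plaquette holonomy is invariant under the layer flip by a CENTRAL `z`**: a temporal plaquette
`(x; 0, j)` contains its two temporal links `(x,0)`, `(x+eⱼ,0)` — both in the layer `x₀` — as `z U ⋯ (z U)⁻¹`,
and spatial plaquettes contain no temporal link. (Stub; lattice bookkeeping.) -/
theorem plaquetteHolonomyZd_flipLayer (z : G) (hz : ∀ g : G, z * g = g * z) (t₀ : ℤ)
    (U : LGConfig 4 G) (x : Site 4) (i j : Fin 4) (hij : i < j) :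
    plaquetteHolonomyZd (flipLayer z t₀ U) x i j = plaquetteHolonomyZd U x i j := by
  have key : ∀ X : G, z * X * z⁻¹ = X := fun X => by rw [hz X, mul_inv_cancel_right]
  have alg : ∀ a b c d : G, z * a * b * (z * c)⁻¹ * d⁻¹ = a * b * c⁻¹ * d⁻¹ := by
    intro a b c d
    rw [mul_inv_rev, show z * a * b * (c⁻¹ * z⁻¹) = z * (a * b * c⁻¹) * z⁻¹ by simp only [mul_assoc], key]
  have hj : j ≠ 0 := by
    rintro rfl
    exact absurd hij (not_lt.mpr (Fin.zero_le i))
  have h1 : (x + (Pi.single j 1 : Fin 4 → ℤ)) 0 = x 0 := by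
    simp [Pi.single_apply, hj.symm]
  unfold plaquetteHolonomyZd flipLayer
  by_cases hi : i = 0
  · subst hi
    by_cases ht : x 0 = t₀
    · have h3 : (x + (Pi.single j 1 : Fin 4 → ℤ)) 0 = t₀ := h1.trans ht
      simp only [ht, h3, hj, true_and, and_true, false_and, if_true, if_false]
      exact alg _ _ _ _
    · have h3 : ¬ (x + (Pi.single j 1 : Fin 4 → ℤ)) 0 = t₀ := fun h => ht (h1.symm.trans h)
      simp only [ht, h3, hj, and_false, false_and, if_false]
  · simp only [hi, hj, false_and, if_false]

/-- **The boundary Wilson action is flip-invariant** (from `plaquetteHolonomyZd_flipLayer`). -/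
theorem wilsonBoundaryAction_flipLayer {N : ℕ} (ρ : G →* Matrix (Fin N) (Fin N) ℂ) (z : G)
    (hz : ∀ g : G, z * g = g * z) (t₀ : ℤ) (Λ : Finset (Literature.MathematicalPhysics.QuantumLattice.ZdEdge 4)) (U : LGConfig 4 G) :
    wilsonBoundaryAction ρ Λ (flipLayer z t₀ U) = wilsonBoundaryAction ρ Λ U := by
  unfold wilsonBoundaryAction
  refine Finset.sum_congr rfl fun p _ => ?_
  simp only [plaquetteObs, plaquetteHolonomyZd_flipLayer z hz t₀ U p.1 p.2.1.1 p.2.1.2 p.2.2]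

variable [TopologicalSpace G] [IsTopologicalGroup G] [CompactSpace G] [MeasurableSpace G] [BorelSpace G]

/-- **FIRST LEMMA of card `centre-flip-thermal-floor` — exact layer-flip covariance of the Wilson
specification**: for every finite edge set `Λ`, every exterior `η`, every central `z` and every layer `t₀`,
the kernel with exterior `flipLayer z t₀ η` is the push-forward of the kernel with exterior `η` under the flip
of the interior (product Haar is left-invariant coordinatewise, the action is flip-invariant). NO geometric
hypothesis on `Λ`. The twin of the tree's named fact `ymSpecification_map_gaugeTransformZd`. -/
theorem ymSpecification_map_flipLayer [SecondCountableTopology G] {N : ℕ}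
    (ρ : G →* Matrix (Fin N) (Fin N) ℂ) (hρ : Continuous ρ) (z : G) (hz : ∀ g : G, z * g = g * z)
    (β : ℝ) (t₀ : ℤ) (Λ : Finset (Literature.MathematicalPhysics.QuantumLattice.ZdEdge 4)) (η : LGConfig 4 G) :
    (ymSpecification ρ β Λ η).map (flipLayer z t₀) = ymSpecification ρ β Λ (flipLayer z t₀ η) := by
  sorry

/-- **Charged observables pick up the character**: if `f ∘ flipLayer z t₀ = c • f` (e.g. `f` = the trace of the
wall-to-wall temporal line through a cell, `c = ω` with `ρ z = ω • 1`), then its kernel expectation under the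
flipped exterior is `c` times that under `η`. With `η'` := flipped exterior AGREEING with `η` on the cube (the
flipped layer meets no frozen cube cell), this is an influence `|1 − Re c| · |γ(f | η)|` on a central-cell
observable at every window `n` — the DS finite-size condition fails wherever the frozen-plate slab is ORDERED. -/
theorem integral_flipLayer_charged [SecondCountableTopology G] {N : ℕ}
    (ρ : G →* Matrix (Fin N) (Fin N) ℂ) (hρ : Continuous ρ) (z : G) (hz : ∀ g : G, z * g = g * z)
    (β : ℝ) (t₀ : ℤ) (Λ : Finset (Literature.MathematicalPhysics.QuantumLattice.ZdEdge 4)) (η : LGConfig 4 G) (f : LGConfig 4 G → ℂ)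
    (hf : Measurable f) (c : ℂ) (hc : ∀ U, f (flipLayer z t₀ U) = c * f U) :
    ∫ U, f U ∂(ymSpecification ρ β Λ (flipLayer z t₀ η)) = c * ∫ U, f U ∂(ymSpecification ρ β Λ η) := by
  sorry

end Flip

end Summit.QuantumFields.YangMills.Cruxes.CertifiedHypercubicLimit.Ideator2

end
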